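import Literature.Computability.Complexity.KWisePolynomialFamily
import Literature.Computability.Complexity.AdderBlocks
import HarnessLib

/-!
# Circuit size of the members of the polynomial `k`-wise uniform family

Every member `x ↦ ⟨first coordinate of Σ_{j<k} aⱼ · enc(x)^j⟩` of the family
`Literature.Computability.Complexity.PolyFamily.fam` (coefficients `a ∈ GF(2ⁿ)ᵏ`) is computed
by a `B₂`-circuit with `O(k · n³)` gates: Horner's rule, each stage a `GF(2)`-bilinear
multiplication circuit in the fixed basis (`n²` AND gates followed by `n` XOR-forms of fan-in
`n²`) and an addition of the constant `aⱼ` (`n` gates).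

* `PolyFamily.toBits`, `PolyFamily.mulBits`, `PolyFamily.cktSize_mulBits` — multiplication in
  `GF(2ⁿ)` on coordinate vectors costs `n² + n (n² + 1)` gates;
* `PolyFamily.cktSize_hornerState` — the Horner recursion;
* **`PolyFamily.circuitSizeOver_fam_le`** — `circuitSizeOver B₂ (fam hn k a) ≤ famSize n k` with
  `famSize n k = n + k · (n² + n (n² + 1) + n)` (`famSize_le : ≤ (k + 1) · 4 n³` for `n ≥ 1`).

## References

* Folklore (schoolbook multiplication in `GF(2ⁿ)`; Horner's rule); H. Vollmer, *Introduction to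
  Circuit Complexity* (1999), §1.
-/

noncomputable section

namespace Literature.Computability.Complexity

open Finset

namespace PolyFamily

variable {n : ℕ}

/-! ### Coordinates -/

/-- The coordinate bits of a field element in the fixed basis. [folklore] -/
def toBits (hn : n ≠ 0) (z : 𝔽 n) : Fin n → Bool := fun i => zBit ((basis hn).equivFun z i)

/-- The coordinates of an encoded point are its bits. [folklore] -/
@[simp] theorem equivFun_enc (hn : n ≠ 0) (x : Fin n → Bool) (i : Fin n) :
    (basis hn).equivFun (enc hn x) i = bitZ (x i) := by
  rw [enc, LinearEquiv.apply_symm_apply]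

/-- `toBits ∘ enc = id`. [folklore] -/
@[simp] theorem toBits_enc (hn : n ≠ 0) (x : Fin n → Bool) : toBits hn (enc hn x) = x := by
  funext i; simp [toBits]

/-- `enc ∘ toBits = id`. [folklore] -/
@[simp] theorem enc_toBits (hn : n ≠ 0) (z : 𝔽 n) : enc hn (toBits hn z) = z := by
  unfold enc toBits
  have : (fun i => bitZ (zBit ((basis hn).equivFun z i))) = (basis hn).equivFun z := by
    funext i; simp
  rw [this, LinearEquiv.symm_apply_apply]

/-- Bits of a sum are XORs of bits. [folklore] -/
theorem toBits_add (hn : n ≠ 0) (z w : 𝔽 n) (i : Fin n) :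
    toBits hn (z + w) i = xor (toBits hn z i) (toBits hn w i) := by
  simp [toBits, map_add, zBit_add]

/-- Bits of zero are zero. [folklore] -/
@[simp] theorem toBits_zero (hn : n ≠ 0) (i : Fin n) : toBits hn 0 i = false := by
  simp only [toBits, map_zero, Pi.zero_apply]
  decide

/-- The family member in terms of bits: `fam a x = toBits (peval a (enc x)) 0`. [folklore] -/
theorem fam_eq_toBits (hn : n ≠ 0) (k : ℕ) (a : Fin k → 𝔽 n) (x : Fin n → Bool) :
    fam hn k a x = toBits hn (peval k a (enc hn x)) ⟨0, Nat.pos_of_ne_zero hn⟩ := rfl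

/-- `bitZ` of an AND is the product. [folklore] -/
theorem bitZ_and (b c : Bool) : bitZ (b && c) = bitZ b * bitZ c := by
  cases b <;> cases c <;> decide

/-! ### Multiplication is bilinear in the coordinates -/

/-- The structure constants of `GF(2ⁿ)` in the fixed basis: coordinate `m` of `bᵢ · bₗ`. [folklore] -/
def mulCoeff (hn : n ≠ 0) (p : Fin n × Fin n) (m : Fin n) : ZMod 2 :=
  (basis hn).equivFun (basis hn p.1 * basis hn p.2) m

/-- **Multiplication is a bilinear form in the coordinates**: coordinate `m` of `u v` is
`Σ_{i,l} c_{ilm} uᵢ vₗ`. [folklore] -/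
theorem equivFun_mul (hn : n ≠ 0) (u v : 𝔽 n) (m : Fin n) :
    (basis hn).equivFun (u * v) m =
      ∑ p : Fin n × Fin n, mulCoeff hn p m * ((basis hn).equivFun u p.1 * (basis hn).equivFun v p.2) := by
  set b := basis hn with hb
  have hu : u = ∑ i, b.equivFun u i • b i := (b.sum_equivFun u).symm
  have hv : v = ∑ l, b.equivFun v l • b l := (b.sum_equivFun v).symm
  conv_lhs => rw [hu, hv, Finset.sum_mul_sum, ← Finset.sum_product']
  rw [map_sum, Finset.sum_apply]
  refine Finset.sum_congr (by simp) fun p _ => ?_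
  rw [show (b.equivFun u p.1 • b p.1) * (b.equivFun v p.2 • b p.2) =
      (b.equivFun u p.1 * b.equivFun v p.2) • (b p.1 * b p.2) by
    simp only [mul_smul_comm, smul_smul, mul_comm], map_smul, Pi.smul_apply,
    smul_eq_mul, mulCoeff, mul_comm]

/-- Field multiplication on coordinate vectors: input wires `inl` = bits of `u`, `inr` = bits of
`v`; output = bits of `u v`. [folklore] -/
def mulBits (hn : n ≠ 0) (w : Fin n ⊕ Fin n → Bool) : Fin n → Bool :=
  toBits hn (enc hn (fun i => w (Sum.inl i)) * enc hn (fun l => w (Sum.inr l)))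

/-- The gate count of the multiplication block. [folklore] -/
def mulSize (n : ℕ) : ℕ := n * n + n * (n * n + 1)

/-- **Multiplication in `GF(2ⁿ)` costs `n² + n (n² + 1)` gates over `B₂`** (all products
`uᵢ ∧ vₗ`, then one XOR-form per output coordinate). [folklore] -/
theorem cktSize_mulBits (hn : n ≠ 0) : CktSize B2 (mulBits hn) (mulSize n) := by
  classical
  -- layer 1: the `n²` products
  have h1 : CktSize B2 (fun (w : Fin n ⊕ Fin n → Bool) (p : Fin n × Fin n) =>
      w (Sum.inl p.1) && w (Sum.inr p.2)) (Fintype.card (Fin n × Fin n) * 1) :=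
    CktSize.pi_const fun p => cktSize_bin (fun a b => a && b) (Sum.inl p.1) (Sum.inr p.2)
  -- layer 2: the XOR-forms with the structure constants
  have h2 := cktSize_linearMap (ι := Fin n × Fin n) (κ := Fin n) (fun m p => mulCoeff hn p m)
  have h := h1.comp h2
  have hs : Fintype.card (Fin n × Fin n) * 1 +
      Fintype.card (Fin n) * (Fintype.card (Fin n × Fin n) + 1) = mulSize n := by
    simp [mulSize, Fintype.card_prod]
  rw [hs] at h
  refine h.congr fun w m => ?_
  rw [mulBits, toBits, equivFun_mul]
  congr 1
  refine Finset.sum_congr rfl fun p _ => ?_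
  rw [equivFun_enc, equivFun_enc, bitZ_and]

/-! ### Horner's rule -/

/-- One Horner stage with the constant `c`: `(u, h) ↦ (u, c + u · h)` on coordinate vectors.
[folklore] -/
def hornerStep (hn : n ≠ 0) (c : 𝔽 n) (w : Fin n ⊕ Fin n → Bool) : Fin n ⊕ Fin n → Bool :=
  Sum.elim (fun i => w (Sum.inl i)) (fun m => xor (mulBits hn w m) (toBits hn c m))

/-- The gate count of one Horner stage. [folklore] -/
def stepSize (n : ℕ) : ℕ := mulSize n + n

/-- One Horner stage costs `mulSize n + n` gates. [folklore] -/
theorem cktSize_hornerStep (hn : n ≠ 0) (c : 𝔽 n) : CktSize B2 (hornerStep hn c) (stepSize n) := by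
  have hx : CktSize B2 (fun (w : Fin n ⊕ Fin n → Bool) (m : Fin n) =>
      xor (mulBits hn w m) (toBits hn c m)) (mulSize n + Fintype.card (Fin n) * 1) :=
    (cktSize_mulBits hn).comp (CktSize.pi_const fun m => cktSize_xorConst m (toBits hn c m))
  have h := (CktSize.proj B2 (fun i : Fin n => (Sum.inl i : Fin n ⊕ Fin n))).pair hx
  have hs : 0 + (mulSize n + Fintype.card (Fin n) * 1) = stepSize n := by simp [stepSize]
  rw [hs] at h
  exact h.congr fun w s => by cases s <;> rfl

/-- Semantics of a Horner stage on a well-formed state. [folklore] -/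
theorem hornerStep_state (hn : n ≠ 0) (c : 𝔽 n) (x : Fin n → Bool) (h : 𝔽 n) :
    hornerStep hn c (Sum.elim x (toBits hn h)) = Sum.elim x (toBits hn (c + enc hn x * h)) := by
  funext s
  cases s with
  | inl i => rfl
  | inr m =>
    simp only [hornerStep, Sum.elim_inr, Sum.elim_inl, mulBits]
    rw [toBits_add, Bool.xor_comm]
    congr 1
    change toBits hn (enc hn x * enc hn (toBits hn h)) m = _
    rw [enc_toBits]

/-- The gate count of the whole evaluation: `n + k · stepSize n`. [folklore] -/
def famSize (n k : ℕ) : ℕ := n + k * stepSize n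

/-- **Horner's rule as a circuit**: the state `(x, bits of peval a (enc x))` is computed with
`famSize n k` gates. [folklore] -/
theorem cktSize_hornerState (hn : n ≠ 0) : ∀ (k : ℕ) (a : Fin k → 𝔽 n),
    CktSize B2 (fun (x : Fin n → Bool) => Sum.elim x (toBits hn (peval k a (enc hn x)))) (famSize n k)
  | 0, a => by
    have h := (CktSize.id B2 (ι := Fin n)).pair
      (CktSize.pi_const (κ := Fin n) fun m => cktSize_const (Fin n) false)
    have hs : 0 + Fintype.card (Fin n) * 1 = famSize n 0 := by simp [famSize]
    rw [hs] at h
    refine h.congr fun x s => ?_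
    cases s with
    | inl i => rfl
    | inr m => simp [peval]
  | k + 1, a => by
    have ih := cktSize_hornerState hn k (fun j => a j.succ)
    have h := ih.comp (cktSize_hornerStep hn (a 0))
    have hs : famSize n k + stepSize n = famSize n (k + 1) := by simp [famSize]; ring
    rw [hs] at h
    refine h.congr fun y s => ?_
    rw [hornerStep_state]
    rfl

/-- **Every member of the family has a circuit of size `famSize n k` over `B₂`** (as a
`CktSize` realisation with one output). [folklore] -/
theorem cktSize_fam (hn : n ≠ 0) (k : ℕ) (a : Fin k → 𝔽 n) :
    CktSize B2 (fun (x : Fin n → Bool) (_ : Unit) => fam hn k a x) (famSize n k) :=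
  ((cktSize_hornerState hn k a).outMap fun _ : Unit =>
    (Sum.inr ⟨0, Nat.pos_of_ne_zero hn⟩ : Fin n ⊕ Fin n)).congr fun _ _ => rfl

/-- **Circuit complexity of the family members**: `circuitSizeOver B₂ (fam a) ≤ famSize n k`.
[folklore] -/
theorem circuitSizeOver_fam_le (hn : n ≠ 0) (k : ℕ) (a : Fin k → 𝔽 n) :
    circuitSizeOver B2 (fam hn k a) ≤ famSize n k := by
  obtain ⟨C, hC, hsz, hev⟩ := (cktSize_fam hn k a).toCircuit
  exact (circuitSizeOver_le_of_computes C hC hev).trans hsz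

/-- A crude closed form: `famSize n k ≤ 4 (k + 1) n³` for `n ≥ 1`. [folklore] -/
theorem famSize_le (hn : 1 ≤ n) (k : ℕ) : famSize n k ≤ 4 * (k + 1) * n ^ 3 := by
  unfold famSize stepSize mulSize
  have h1 : n ≤ n ^ 3 := by
    calc n = n * 1 * 1 := by ring
      _ ≤ n * n * n := by gcongr
      _ = n ^ 3 := by ring
  have h2 : n * n ≤ n ^ 3 := by
    calc n * n = n * n * 1 := by ring
      _ ≤ n * n * n := by gcongr
      _ = n ^ 3 := by ring
  have h3 : n * (n * n + 1) + n ≤ 2 * n ^ 3 + 0 * 0 + n := by nlinarith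
  nlinarith

end PolyFamily

end Literature.Computability.Complexity
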